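import Summits.HodgeConjecture.HodgeCM.Automorphic.WeilThetaModelLinear_1

/-! PORT of `HodgeCM/Automorphic/WeilThetaModelLinear.lean` (HodgeCMPerL run 82) — part 2: continuation of `Summits.HodgeConjecture.HodgeCM.Automorphic.WeilThetaModelLinear_1` (split at a top-level declaration boundary by port_pkg.py; scope re-opened below; declarations unchanged). -/

-- port_pkg: scope re-opened for this part (file-level context, then the namespace/section stack open at the cut)
set_option autoImplicit false
noncomputable section
open Topology
namespace HodgeCM
open Literature.Theta
namespace WeilThetaModel
open MeasureTheory PerL34.KernelOperator
variable {GU : Type} [Group GU] [TopologicalSpace GU] [IsTopologicalGroup GU] {ΓU : Subgroup GU}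
variable {G : Type} [Group G] [TopologicalSpace G] [IsTopologicalGroup G] {Γ : Subgroup G}
variable (M : WeilThetaModel GU ΓU G Γ) [M.LinearStr]
variable [CompactSpace (GU ⧸ ΓU)] [CompactSpace (G ⧸ Γ)] [MeasurableSpace (G ⧸ Γ)] [BorelSpace (G ⧸ Γ)]
  (ν : Measure (G ⧸ Γ)) [IsFiniteMeasure ν]
/-- `Φ ↦ 𝒯_{θ_Φ}` as a `ℂ`-linear map `𝒮^κ →ₗ[ℂ] (L²([U(W)]) →L[ℂ] C([G_U], ℂ))`. -/
def opTCθₗ : M.SK →ₗ[ℂ] (Lp ℂ 2 ν →L[ℂ] C(GU ⧸ ΓU, ℂ)) :=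
  (opTCₗ ν).comp M.θₗ

/-- (Ported verbatim from the HodgeCMPerL package; no docstring in the source.) -/
@[simp] theorem opTCθₗ_apply (Φ : M.SK) : M.opTCθₗ ν Φ = opTC (M.θ Φ) ν := rfl

/-- `Φ ↦ 𝒯_{θ_Φ}` is continuous for the operator norm (structural law 2 + pv05's bound
`‖𝒯_k‖ ≤ ν^{1/2} ‖k‖_∞`, through the bounded linear map `k ↦ 𝒯_k`). -/
theorem opTCθₗ_continuous : Continuous (M.opTCθₗ ν) := by
  have hb : Continuous fun k : C((GU ⧸ ΓU) × (G ⧸ Γ), ℂ) => opTC k ν := by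
    refine ((opTCₗ (X := GU ⧸ ΓU) ν).mkContinuous ((measureUnivNNReal ν : ℝ) ^ (2 : ℝ)⁻¹) fun k => ?_).continuous
    simpa only [opTCₗ_apply] using norm_opTC_le k ν
  exact hb.comp M.θ_cont

end WeilThetaModel

/-! ## 5. Non-vacuity: the archimedean Schrödinger–lattice model is a linear Weil theta model -/

namespace SchwartzWeil

open scoped SchwartzMap

variable (E : Type) [NormedAddCommGroup E] [NormedSpace ℝ E] [FiniteDimensional ℝ E]
  (L : Submodule ℤ E) [DiscreteTopology L] (m : ℤ) (Γ : Subgroup Circle) (hΓ : ∀ u ∈ Γ, u ^ m = 1)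

/-- **pv14-g4's Schrödinger–lattice `WeilThetaModel` is LINEAR**: `S(X_A) = 𝓢(E, ℂ)` with its Schwartz-space
structure, `act`/`theta` linear by pv14-g4's `act_add / act_smul / theta_add / theta_smul`
(`WeilThetaModelSchrodingerLinear`), `SK = univ`. -/
instance linearStr_schrodingerModel : (schrodingerModel E L m Γ hΓ).LinearStr where
  instACG := inferInstanceAs (AddCommGroup 𝓢(E, ℂ))
  instMod := inferInstanceAs (Module ℂ 𝓢(E, ℂ))
  act_add := act_add E m
  act_smul := act_smul E m
  theta_add := theta_add E L m
  theta_smul := theta_smul E L m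
  zero_mem := Set.mem_univ _
  add_mem := fun _ _ => Set.mem_univ _
  smul_mem := fun _ _ _ => Set.mem_univ _

/-- The same for `Γ = ⊥`. -/
instance linearStr_schrodingerModelBot : (schrodingerModelBot E L m).LinearStr :=
  inferInstanceAs ((schrodingerModel E L m ⊥ fun u hu => by rw [Subgroup.mem_bot.1 hu, one_zpow]).LinearStr)

/-- Consistency with pv14-g4's `θLinear`: on `toSK Φ = ⟨Φ, _⟩` the two linear structures agree (`rfl`), so
`θₗ (toSK Φ) = θLinear Φ`. -/
theorem θₗ_toSK (Φ : 𝓢(E, ℂ)) :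
    (schrodingerModel E L m Γ hΓ).θₗ (toSK E L m Γ hΓ Φ) = θLinear E L m Γ hΓ Φ := rfl

/-- (Ported verbatim from the HodgeCMPerL package; no docstring in the source.) -/
theorem toSK_add (Φ Ψ : 𝓢(E, ℂ)) :
    toSK E L m Γ hΓ (Φ + Ψ) = toSK E L m Γ hΓ Φ + toSK E L m Γ hΓ Ψ := rfl

/-- (Ported verbatim from the HodgeCMPerL package; no docstring in the source.) -/
theorem toSK_smul (c : ℂ) (Φ : 𝓢(E, ℂ)) : toSK E L m Γ hΓ (c • Φ) = c • toSK E L m Γ hΓ Φ := rfl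

/-- `toSK` is a `ℂ`-linear isomorphism `𝓢(E, ℂ) ≃ₗ[ℂ] 𝒮^κ` (`SK = univ`). -/
def toSKₗ : 𝓢(E, ℂ) ≃ₗ[ℂ] (schrodingerModel E L m Γ hΓ).SK where
  toFun := toSK E L m Γ hΓ
  map_add' := toSK_add E L m Γ hΓ
  map_smul' := toSK_smul E L m Γ hΓ
  invFun := Subtype.val
  left_inv _ := rfl
  right_inv _ := rfl

/-- (Ported verbatim from the HodgeCMPerL package; no docstring in the source.) -/
@[simp] theorem toSKₗ_apply (Φ : 𝓢(E, ℂ)) : toSKₗ E L m Γ hΓ Φ = toSK E L m Γ hΓ Φ := rfl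

end SchwartzWeil

end HodgeCM

end
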